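import Mathlib
import HarnessLib
import Summits.Ventures.LatticeQCDFlow.Exactness.SphereTimeDependentFlow

/-!
# `ℓ¹`-stability of the time-dependent trivializing flow on the lattice of site spheres: `Σ_n ‖Φ_{t₀→t₁}(x)_n − Φ_{t₀→t₁}(y)_n‖ ≤ e^{K|t₁−t₀|}·Σ_n ‖x_n − y_n‖` for every generator with an `ℓ¹`-Lipschitz gradient, uniformly in the volume

HONEST FRAMING: exact (Metropolis-corrected) sampling algorithms for lattice gauge theory;
figures of merit are autocorrelation/cost numbers at stated couplings and volumes; no
continuum-physics claim.

Venture `LatticeQCDFlow` (cell pub-lqcd), topic `Exactness`; FANOUT row 7 (`s0-cpn-null`: the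
S0-D1 rung — 2D CP⁹, Lüscher's LO trivializing map inside HMC, Engel–Schaefer 2011).  NEW WORK of
the cell over Mathlib (`norm_le_gronwallBound_of_norm_deriv_right_le`, `PiLp 1`) and the tree's
`Exactness/SphereTimeDependentFlow.lean` (GEN-14: the evolution maps `Φ_{t₀→t}` of
`ẋ_n = −∂̃_nG_t(x)`, conserved site norms, the cut-off equation at every time); nothing is cited
as a fact.  Printed counterpart, NAMED ONLY: M. Lüscher, Commun. Math. Phys. 293 (2010) 899,
§3.1–3.2 (the flow of a `t`-dependent generator on a compact field manifold) and §4.5 (locality of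
the generator); the gauge-side sup-norm statement is lean-1's `Scaling/FlowLipschitzBudget.lean`
(`Φ_1` is `e^K`-Lipschitz in the sup metric) and theory-1's THEOREM L
(`TrivializingMaps/FlowLightCone.lean`).  THIS FILE is the `ℓ¹` (absolutely summed) counterpart on
the product of site spheres — the form that controls how much a flow-defined functional can change
when ONE site of the initial configuration is modified (bounded differences; sequel
`Exactness/SphereLOFlowL1Stability.lean`, McDiarmid / Efron–Stein in
`Exactness/LatticeBoundedDifferences.lean`).

## Setting

`E` a finite-dimensional real inner product space, `Λ` a finite set of sites, `Ω̃ = {x | ‖x_n‖ = 1}`;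
`G : ℝ → (Λ → E) → ℝ` jointly `C²`, horizon `T`, `Φ_{t₀→t₁} = sphereTDFlow hG T t₀ t₁`.  THE
`ℓ¹`-MODULUS OF THE GENERATOR on the segment between `t₀` and `t₁`:
`Σ_i ‖∂̃_iG_t(x) − ∂̃_iG_t(y)‖ ≤ K·Σ_j ‖x_j − y_j‖` for `x, y ∈ Ω̃` (a COLUMN-SUM bound on the
site-Lipschitz matrix of the generator; for a local generator `K` does not depend on `|Λ|`).

## Content

* §1 `mem_uIcc_affine` (the segment parametrisation), **`hasDerivAt_sphereTDFlow_affine`** (the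
  flow line reparametrised to `[0, 1]`: `u ↦ Φ_{t₀→t₀+u(t₁−t₀)}(x)` solves
  `ẋ = (t₁−t₀)·X_T(t₀+u(t₁−t₀), x)`).
* §2 **`sum_norm_sphereTDFlow_sub_le`** — THE `ℓ¹`-STABILITY ESTIMATE: under the `ℓ¹`-modulus
  with constant `K`, for all `x, y ∈ Ω̃` and all `t₀, t₁`,
  `Σ_n ‖Φ_{t₀→t₁}(x)_n − Φ_{t₀→t₁}(y)_n‖ ≤ exp(K|t₁ − t₀|)·Σ_n ‖x_n − y_n‖`
  (Grönwall in `ℓ¹(Λ; E) = PiLp 1`; the time cut-off `ψ_T ∈ [0, 1]` only helps);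
  **`sum_norm_sphereTDFlow_update_sub_le`** — ONE-SITE MODIFICATIONS: replacing `x_k` by another
  unit vector `v` moves the flowed configuration by at most `e^{K|t₁−t₀|}·‖x_k − v‖ ≤ 2e^{K|t₁−t₀|}`
  IN TOTAL over all sites — the input of the bounded-differences method for every flow-defined
  observable.

NOT CLAIMED: the site-resolved light cone (sup form with the factorial profile — that is THEOREM L,
instantiated separately); any statement for generators without an `ℓ¹`-modulus; sharpness of
`e^{K|t|}`; numbers of the rung.
-/

noncomputable section

namespace Summit.Ventures.LatticeQCDFlow.Exactness

open Function Set Metric NormedSpace InnerProductSpace Real WithLp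
open scoped RealInnerProductSpace Topology

variable {Λ : Type*} {E : Type*} [NormedAddCommGroup E] [InnerProductSpace ℝ E]
  [FiniteDimensional ℝ E] [Fintype Λ] [DecidableEq Λ] {G : ℝ → (Λ → E) → ℝ} {T : ℝ}

/-! ## §1 The flow line reparametrised to the unit interval -/

section Affine

omit [FiniteDimensional ℝ E] [Fintype Λ] [DecidableEq Λ] in
/-- The affine parametrisation of the segment: `t₀ + u(t₁ − t₀) ∈ [[t₀, t₁]]` for `u ∈ [0, 1]`. -/
theorem mem_uIcc_affine {t₀ t₁ u : ℝ} (hu : u ∈ Icc (0 : ℝ) 1) :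
    t₀ + u * (t₁ - t₀) ∈ uIcc t₀ t₁ := by
  rcases le_total t₀ t₁ with h | h
  · rw [uIcc_of_le h]
    constructor <;> nlinarith [hu.1, hu.2]
  · rw [uIcc_of_ge h]
    constructor <;> nlinarith [hu.1, hu.2]

/-- **The reparametrised flow line**: `u ↦ Φ_{t₀→t₀+u(t₁−t₀)}(x)` has derivative
`(t₁ − t₀)·X_T(t₀ + u(t₁−t₀), Φ_{t₀→t₀+u(t₁−t₀)}(x))` at every `u` (chain rule on the cut-off
equation). -/
theorem hasDerivAt_sphereTDFlow_affine (hG : ContDiff ℝ 2 fun q : ℝ × (Λ → E) => G q.1 q.2)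
    (t₀ t₁ : ℝ) (x : Λ → E) (u : ℝ) :
    HasDerivAt (fun u : ℝ => sphereTDFlow hG T t₀ (t₀ + u * (t₁ - t₀)) x)
      ((t₁ - t₀) • sphereTDField G T
        (t₀ + u * (t₁ - t₀), sphereTDFlow hG T t₀ (t₀ + u * (t₁ - t₀)) x)) u := by
  have hh : HasDerivAt (fun u : ℝ => t₀ + u * (t₁ - t₀)) (t₁ - t₀) u := by
    have h := ((hasDerivAt_id u).mul_const (t₁ - t₀)).const_add t₀
    simpa only [id, one_mul] using h
  have hf := hasDerivAt_sphereTDFlow_field hG t₀ x (t₀ + u * (t₁ - t₀)) (T := T)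
  exact hf.scomp u hh

end Affine

/-! ## §2 Grönwall in `ℓ¹(Λ; E)` -/

section L1

omit [InnerProductSpace ℝ E] [FiniteDimensional ℝ E] [DecidableEq Λ] in
/-- The `ℓ¹` norm of a lattice vector moved to `PiLp 1`. -/
theorem norm_toLp_one_eq_sum (f : Λ → E) :
    ‖toLp 1 f‖ = ∑ i, ‖f i‖ := by
  rw [PiLp.norm_eq_of_L1]

/-- **THE `ℓ¹`-STABILITY OF THE TIME-DEPENDENT FLOW.**  If the generator's natural gradient has the
`ℓ¹`-modulus `Σ_i ‖∂̃_iG_t(x) − ∂̃_iG_t(y)‖ ≤ K·Σ_j ‖x_j − y_j‖` on `Ω̃` for every `t` between `t₀`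
and `t₁`, then for all `x, y ∈ Ω̃`:
`Σ_n ‖Φ_{t₀→t₁}(x)_n − Φ_{t₀→t₁}(y)_n‖ ≤ exp(K|t₁ − t₀|)·Σ_n ‖x_n − y_n‖`. -/
theorem sum_norm_sphereTDFlow_sub_le (hG : ContDiff ℝ 2 fun q : ℝ × (Λ → E) => G q.1 q.2)
    {K : ℝ} {t₀ t₁ : ℝ}
    (hmod : ∀ t ∈ uIcc t₀ t₁, ∀ x y : Λ → E, (∀ n, ‖x n‖ = 1) → (∀ n, ‖y n‖ = 1) →
      ∑ i, ‖siteGrad i (G t) x - siteGrad i (G t) y‖ ≤ K * ∑ j, ‖x j - y j‖)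
    {x y : Λ → E} (hx : ∀ n, ‖x n‖ = 1) (hy : ∀ n, ‖y n‖ = 1) :
    ∑ i, ‖sphereTDFlow hG T t₀ t₁ x i - sphereTDFlow hG T t₀ t₁ y i‖ ≤
      Real.exp (K * |t₁ - t₀|) * ∑ j, ‖x j - y j‖ := by
  -- the two reparametrised flow lines and their difference in `ℓ¹(Λ; E)`
  set X : ℝ → (Λ → E) := fun u => sphereTDFlow hG T t₀ (t₀ + u * (t₁ - t₀)) x with hXdef
  set Y : ℝ → (Λ → E) := fun u => sphereTDFlow hG T t₀ (t₀ + u * (t₁ - t₀)) y with hYdef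
  set X' : ℝ → (Λ → E) := fun u => (t₁ - t₀) • sphereTDField G T (t₀ + u * (t₁ - t₀), X u)
    with hX'def
  set Y' : ℝ → (Λ → E) := fun u => (t₁ - t₀) • sphereTDField G T (t₀ + u * (t₁ - t₀), Y u)
    with hY'def
  have hXd : ∀ u, HasDerivAt X (X' u) u := fun u => hasDerivAt_sphereTDFlow_affine hG t₀ t₁ x u
  have hYd : ∀ u, HasDerivAt Y (Y' u) u := fun u => hasDerivAt_sphereTDFlow_affine hG t₀ t₁ y u
  set F : ℝ → PiLp 1 (fun _ : Λ => E) := fun u => toLp 1 (X u - Y u) with hFdef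
  set F' : ℝ → PiLp 1 (fun _ : Λ => E) := fun u => toLp 1 (X' u - Y' u) with hF'def
  -- the derivative of the difference, transported by the continuous linear map `toLp 1`
  have hFd : ∀ u, HasDerivAt F (F' u) u := by
    intro u
    have hd : HasDerivAt (fun u => X u - Y u) (X' u - Y' u) u := (hXd u).sub (hYd u)
    have hL := ((PiLp.continuousLinearEquiv 1 ℝ (fun _ : Λ => E)).symm :
      (Λ → E) →L[ℝ] PiLp 1 (fun _ : Λ => E)).hasFDerivAt.comp_hasDerivAt u hd
    exact hL
  have hFc : ContinuousOn F (Icc 0 1) := fun u _ => (hFd u).continuousAt.continuousWithinAt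
  -- unit site norms along both lines
  have hXn : ∀ u n, ‖X u n‖ = 1 := fun u n => norm_sphereTDFlow_eq_one hG t₀ hx _ n
  have hYn : ∀ u n, ‖Y u n‖ = 1 := fun u n => norm_sphereTDFlow_eq_one hG t₀ hy _ n
  -- the norms
  have hFn : ∀ u, ‖F u‖ = ∑ i, ‖X u i - Y u i‖ := fun u => by
    rw [hFdef, norm_toLp_one_eq_sum]; rfl
  -- the differential inequality `‖F'‖ ≤ K|t₁ − t₀|·‖F‖` on `[0, 1)`
  have hbound : ∀ u ∈ Ico (0 : ℝ) 1, ‖F' u‖ ≤ K * |t₁ - t₀| * ‖F u‖ + 0 := by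
    intro u hu
    rw [add_zero, hF'def, norm_toLp_one_eq_sum, hFn u]
    set t : ℝ := t₀ + u * (t₁ - t₀) with htdef
    have ht : t ∈ uIcc t₀ t₁ := mem_uIcc_affine (Ico_subset_Icc_self hu)
    have hψ0 : 0 ≤ (timeBump T : ℝ → ℝ) t := (timeBump T).nonneg
    have hψ1 : (timeBump T : ℝ → ℝ) t ≤ 1 := (timeBump T).le_one
    -- on `Ω̃` the field is `−ψ_T(t)·∂̃G_t`
    have hXf : sphereTDField G T (t, X u) = fun n => -((timeBump T : ℝ → ℝ) t • siteGrad n (G t) (X u)) :=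
      sphereTDField_eq_of_norm_eq_one t (hXn u)
    have hYf : sphereTDField G T (t, Y u) = fun n => -((timeBump T : ℝ → ℝ) t • siteGrad n (G t) (Y u)) :=
      sphereTDField_eq_of_norm_eq_one t (hYn u)
    have hterm : ∀ i, ‖(X' u - Y' u) i‖ =
        |t₁ - t₀| * ((timeBump T : ℝ → ℝ) t * ‖siteGrad i (G t) (X u) - siteGrad i (G t) (Y u)‖) := by
      intro i
      have e : (X' u - Y' u) i = (t₁ - t₀) • ((timeBump T : ℝ → ℝ) t •
          -(siteGrad i (G t) (X u) - siteGrad i (G t) (Y u))) := by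
        simp only [hX'def, hY'def, Pi.sub_apply, Pi.smul_apply, ← htdef, hXf, hYf, smul_neg, smul_sub]
        abel
      rw [e, norm_smul, norm_smul, norm_neg, Real.norm_eq_abs, Real.norm_eq_abs, abs_of_nonneg hψ0]
    simp_rw [hterm]
    rw [← Finset.mul_sum, ← Finset.mul_sum]
    have hm := hmod t ht (X u) (Y u) (hXn u) (hYn u)
    have hS : 0 ≤ ∑ i, ‖siteGrad i (G t) (X u) - siteGrad i (G t) (Y u)‖ :=
      Finset.sum_nonneg fun i _ => norm_nonneg _
    calc |t₁ - t₀| * ((timeBump T : ℝ → ℝ) t * ∑ i, ‖siteGrad i (G t) (X u) - siteGrad i (G t) (Y u)‖)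
        ≤ |t₁ - t₀| * (1 * (K * ∑ j, ‖X u j - Y u j‖)) := by
          gcongr
      _ = K * |t₁ - t₀| * ∑ j, ‖X u j - Y u j‖ := by ring
  -- the initial value
  have h0 : ‖F 0‖ ≤ ∑ j, ‖x j - y j‖ := by
    rw [hFn 0]
    simp only [hXdef, hYdef, zero_mul, add_zero, sphereTDFlow_self]
    exact le_rfl
  -- Grönwall on `[0, 1]`
  have hG1 := norm_le_gronwallBound_of_norm_deriv_right_le hFc (fun u _ => (hFd u).hasDerivWithinAt)
    h0 hbound 1 ⟨zero_le_one, le_rfl⟩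
  rw [gronwallBound_ε0, sub_zero, mul_one, hFn 1] at hG1
  have h1 : t₀ + 1 * (t₁ - t₀) = t₁ := by ring
  simp only [hXdef, hYdef, h1] at hG1
  rw [mul_comm] at hG1
  exact hG1

/-- **ONE-SITE MODIFICATIONS OF THE INITIAL CONFIGURATION.**  Under the `ℓ¹`-modulus, replacing
the unit vector `x_k` by the unit vector `v` moves the flowed configuration by at most
`exp(K|t₁ − t₀|)·‖x_k − v‖` in total over all sites. -/
theorem sum_norm_sphereTDFlow_update_sub_le (hG : ContDiff ℝ 2 fun q : ℝ × (Λ → E) => G q.1 q.2)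
    {K : ℝ} {t₀ t₁ : ℝ}
    (hmod : ∀ t ∈ uIcc t₀ t₁, ∀ x y : Λ → E, (∀ n, ‖x n‖ = 1) → (∀ n, ‖y n‖ = 1) →
      ∑ i, ‖siteGrad i (G t) x - siteGrad i (G t) y‖ ≤ K * ∑ j, ‖x j - y j‖)
    {x : Λ → E} (hx : ∀ n, ‖x n‖ = 1) (k : Λ) {v : E} (hv : ‖v‖ = 1) :
    ∑ i, ‖sphereTDFlow hG T t₀ t₁ x i - sphereTDFlow hG T t₀ t₁ (update x k v) i‖ ≤
      Real.exp (K * |t₁ - t₀|) * ‖x k - v‖ := by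
  have hy : ∀ n, ‖update x k v n‖ = 1 := by
    intro n
    by_cases hn : n = k
    · subst hn; rw [update_self]; exact hv
    · rw [update_of_ne hn]; exact hx n
  have h := sum_norm_sphereTDFlow_sub_le hG hmod hx hy (T := T)
  have hsum : ∑ j, ‖x j - update x k v j‖ = ‖x k - v‖ := by
    rw [Finset.sum_eq_single k]
    · rw [update_self]
    · intro j _ hj; rw [update_of_ne hj, sub_self, norm_zero]
    · intro hk; exact absurd (Finset.mem_univ k) hk
  rw [hsum] at h
  exact h

/-- The same with the universal constant: the total displacement is at most `2·exp(K|t₁ − t₀|)`,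
whatever the site, the two unit vectors, the configuration and the volume. -/
theorem sum_norm_sphereTDFlow_update_sub_le_two (hG : ContDiff ℝ 2 fun q : ℝ × (Λ → E) => G q.1 q.2)
    {K : ℝ} {t₀ t₁ : ℝ}
    (hmod : ∀ t ∈ uIcc t₀ t₁, ∀ x y : Λ → E, (∀ n, ‖x n‖ = 1) → (∀ n, ‖y n‖ = 1) →
      ∑ i, ‖siteGrad i (G t) x - siteGrad i (G t) y‖ ≤ K * ∑ j, ‖x j - y j‖)
    {x : Λ → E} (hx : ∀ n, ‖x n‖ = 1) (k : Λ) {v : E} (hv : ‖v‖ = 1) :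
    ∑ i, ‖sphereTDFlow hG T t₀ t₁ x i - sphereTDFlow hG T t₀ t₁ (update x k v) i‖ ≤
      2 * Real.exp (K * |t₁ - t₀|) := by
  have h := sum_norm_sphereTDFlow_update_sub_le hG hmod hx k hv (T := T)
  have h2 : ‖x k - v‖ ≤ 2 := by
    calc ‖x k - v‖ ≤ ‖x k‖ + ‖v‖ := norm_sub_le _ _
      _ = 2 := by rw [hx k, hv]; norm_num
  calc _ ≤ Real.exp (K * |t₁ - t₀|) * ‖x k - v‖ := h
    _ ≤ Real.exp (K * |t₁ - t₀|) * 2 := by gcongr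
    _ = 2 * Real.exp (K * |t₁ - t₀|) := by ring

end L1

end Summit.Ventures.LatticeQCDFlow.Exactness

end
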